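import Mathlib.Topology.MetricSpace.Thickening
import Mathlib.Geometry.Manifold.PartitionOfUnity
import Mathlib.Analysis.Calculus.ContDiff.Basic
import HarnessLib

/-!
# Capping a sweep function (Schultens' Schönflies proof, the gluing step)

Topic `Literature/Topology/FourManifolds`.  In the inductive step of the Morse-theoretic proof of
the smooth Schönflies theorem (Schultens, *Introduction to 3-Manifolds* (2014), Thm. 3.2.5,
PDF p. 45) a solid `A₁ = {F₁ ≤ 0}` contains a sub-solid `B = {F_B ≤ 0}` (the ball below an
innermost level circle) which is to be swept away by the level sets of a function `w` supplied by
the induction hypothesis for `B`.  The function `w` is only controlled on `B` and on an explicit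
region `G` (around the lid of `B`); this file caps it off elsewhere:

* `exists_capping`: there are a smooth `ζ : E → [0, 1]` and an open set `T ⊇ B` with `ζ = 1` on
  `T` such that, for the capped function `w̃ = ζ w + (1 - ζ) W` (`W ≥ 1 + 6δ₀`), every point of
  `A₁` with `w̃ ≤ 1 + 3δ₀` lies in `T` (so `w̃ = w` near it), and every point of `T ∩ A₁` with
  `w ≤ 1 + 3δ₀` lies in `B ∪ G`.

The hypotheses are purely topological: local agreement `A₁ = B` near the boundary points of `B`
with small `w` outside `G` (`Hagree`), and a boundary condition for `G` (`Hbdry`).  The proof is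
compactness (`IsCompact.exists_thickening_subset_open`) and the smooth Urysohn lemma.

## References
* J. Schultens, *Introduction to 3-Manifolds*, GSM 151, AMS (2014), Thm. 3.2.5.
* M. W. Hirsch, *Differential Topology*, Springer GTM 33 (1976), §2.2 (smooth Urysohn).
-/

noncomputable section

open Set Metric Filter Topology
open scoped Manifold ContDiff

namespace Literature.Topology.FourManifolds.SweepCapping

variable {E : Type*} [NormedAddCommGroup E] [NormedSpace ℝ E] [FiniteDimensional ℝ E]

/-- **Smooth Urysohn lemma** on a finite-dimensional space: disjoint closed sets are separated by
a `C^∞` function with values in `[0, 1]` (Mathlib's `exists_contMDiffMap_zero_one_of_isClosed` on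
`E` regarded as a manifold). [folklore] -/
theorem exists_contDiff_zero_one {s t : Set E} (hs : IsClosed s) (ht : IsClosed t)
    (hd : Disjoint s t) :
    ∃ χ : E → ℝ, ContDiff ℝ ∞ χ ∧ (∀ x ∈ s, χ x = 0) ∧ (∀ x ∈ t, χ x = 1) ∧
      ∀ x, χ x ∈ Icc (0 : ℝ) 1 := by
  obtain ⟨f, hf0, hf1, hf⟩ := exists_contMDiffMap_zero_one_of_isClosed (I := 𝓘(ℝ, E)) (M := E)
    (n := (⊤ : ℕ∞)) hs ht hd
  exact ⟨f, f.contMDiff.contDiff, fun x hx => hf0 hx, fun x hx => hf1 hx, hf⟩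

omit [NormedSpace ℝ E] [FiniteDimensional ℝ E] in
/-- The frontier of a closed sublevel set `{F ≤ 0}` of a continuous function lies in the zero set.
[folklore] -/
theorem frontier_setOf_le_subset {F : E → ℝ} (hF : Continuous F) :
    frontier {x | F x ≤ 0} ⊆ {x | F x = 0} := by
  intro x hx
  have hcl : IsClosed {x | F x ≤ 0} := isClosed_le hF continuous_const
  have hxle : F x ≤ 0 := hcl.frontier_subset hx
  rcases hxle.lt_or_eq with hlt | heq
  · exfalso
    have hn : {y | F y < 0} ∈ 𝓝 x := (isOpen_lt hF continuous_const).mem_nhds hlt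
    have hint : x ∈ interior {y | F y ≤ 0} :=
      mem_interior_iff_mem_nhds.2 (mem_of_superset hn fun y (hy : F y < 0) => show F y ≤ 0 from le_of_lt hy)
    exact hx.2 hint
  · exact heq

omit [NormedSpace ℝ E] [FiniteDimensional ℝ E] in
/-- **The local lemma.**  Under local agreement of `A₁ = {F₁ ≤ 0}` and `B = {F_B ≤ 0}` near the
boundary points of `B` with `w ≤ 1 + 3δ₀` outside `G`, there is `r > 0` such that every point of
`A₁` within distance `r` of `B` with `w ≤ 1 + 3δ₀` lies in `B ∪ G`. [folklore] -/
theorem exists_thickening_forall_mem {F₁ FB w : E → ℝ} (hFB : Continuous FB) (hw : Continuous w)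
    (hcpt : IsCompact {x | FB x ≤ 0}) {G : Set E} (hG : IsOpen G) {δ₀ : ℝ}
    (Hagree : ∀ b, FB b = 0 → w b ≤ 1 + 3 * δ₀ → b ∉ G → ∀ᶠ y in 𝓝 b, (F₁ y ≤ 0 ↔ FB y ≤ 0)) :
    ∃ r, 0 < r ∧ ∀ x ∈ thickening r {x | FB x ≤ 0}, F₁ x ≤ 0 → w x ≤ 1 + 3 * δ₀ →
      FB x ≤ 0 ∨ x ∈ G := by
  set Agr : Set E := {y | F₁ y ≤ 0 ↔ FB y ≤ 0} with hAgr
  set O : Set E := interior {x | FB x ≤ 0} ∪ interior Agr ∪ {x | 1 + 3 * δ₀ < w x} ∪ G with hO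
  have hOo : IsOpen O :=
    ((isOpen_interior.union isOpen_interior).union (isOpen_lt continuous_const hw)).union hG
  have hBO : {x | FB x ≤ 0} ⊆ O := by
    intro x hx
    by_cases hint : x ∈ interior {x | FB x ≤ 0}
    · exact Or.inl (Or.inl (Or.inl hint))
    have hfr : x ∈ frontier {x | FB x ≤ 0} := ⟨subset_closure hx, hint⟩
    have h0 : FB x = 0 := frontier_setOf_le_subset hFB hfr
    by_cases hwx : 1 + 3 * δ₀ < w x
    · exact Or.inl (Or.inr hwx)
    by_cases hxG : x ∈ G
    · exact Or.inr hxG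
    have hA : Agr ∈ 𝓝 x := Hagree x h0 (not_lt.1 hwx) hxG
    exact Or.inl (Or.inl (Or.inr (mem_interior_iff_mem_nhds.2 hA)))
  obtain ⟨r, hr, hrO⟩ := hcpt.exists_thickening_subset_open hOo hBO
  refine ⟨r, hr, fun x hx hF₁ hwx => ?_⟩
  rcases hrO hx with ((hint | hagr) | hbig) | hxG
  · exact Or.inl (interior_subset (s := {x | FB x ≤ 0}) hint)
  · exact Or.inl ((interior_subset (s := Agr) hagr).1 hF₁)
  · exact absurd hwx (not_le.2 hbig)
  · exact Or.inr hxG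

/-- **Capping a sweep function.**  Let `B = {F_B ≤ 0}` be compact, `w` continuous, `G` open,
`δ₀ > 0`; assume local agreement of `A₁ = {F₁ ≤ 0}` with `B` near the boundary points of `B`
with `w ≤ 1 + 3δ₀` outside `G` (`Hagree`) and that the frontier points of `G` in `A₁` with
`w ≤ 1 + 4δ₀` lie in `B` (`Hbdry`).  Then for `W ≥ 1 + 6δ₀` there are a smooth `ζ : E → [0, 1]`
and an open `T ⊇ B` with `ζ = 1` on `T`, such that `T ∩ A₁ ∩ {w ≤ 1 + 3δ₀} ⊆ B ∪ G` and every
point of `A₁` where the capped function `ζ w + (1 - ζ) W` is `≤ 1 + 3δ₀` lies in `T`.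
[cite: Schultens2014, proof of Thm. 3.2.5 (PDF p. 45)] -/
theorem exists_capping {F₁ FB w : E → ℝ} (hF₁ : Continuous F₁) (hFB : Continuous FB)
    (hw : Continuous w) (hcpt : IsCompact {x | FB x ≤ 0}) {G : Set E} (hG : IsOpen G) {δ₀ : ℝ}
    (hδ₀ : 0 < δ₀)
    (Hagree : ∀ b, FB b = 0 → w b ≤ 1 + 3 * δ₀ → b ∉ G → ∀ᶠ y in 𝓝 b, (F₁ y ≤ 0 ↔ FB y ≤ 0))
    (Hbdry : ∀ x ∈ frontier G, F₁ x ≤ 0 → w x ≤ 1 + 4 * δ₀ → FB x ≤ 0) {W : ℝ}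
    (hW : 1 + 6 * δ₀ ≤ W) :
    ∃ (ζ : E → ℝ) (T : Set E), ContDiff ℝ ∞ ζ ∧ (∀ x, ζ x ∈ Icc (0 : ℝ) 1) ∧ IsOpen T ∧
      {x | FB x ≤ 0} ⊆ T ∧ (∀ x ∈ T, ζ x = 1) ∧
      (∀ x ∈ T, F₁ x ≤ 0 → w x ≤ 1 + 3 * δ₀ → FB x ≤ 0 ∨ x ∈ G) ∧
      (∀ x, F₁ x ≤ 0 → ζ x * w x + (1 - ζ x) * W ≤ 1 + 3 * δ₀ → x ∈ T) := by
  obtain ⟨r, hr, hloc⟩ := exists_thickening_forall_mem (F₁ := F₁) hFB hw hcpt hG Hagree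
  set B : Set E := {x | FB x ≤ 0} with hB
  set T : Set E := thickening (r / 2) B ∪ (G ∩ {x | w x < 1 + 4 * δ₀}) with hT
  set T₂ : Set E := thickening r B ∪ (G ∩ {x | w x < 1 + 5 * δ₀}) with hT₂
  have hTo : IsOpen T := isOpen_thickening.union (hG.inter (isOpen_lt hw continuous_const))
  have hT₂o : IsOpen T₂ := isOpen_thickening.union (hG.inter (isOpen_lt hw continuous_const))
  have hBT : B ⊆ T := fun x hx => Or.inl (self_subset_thickening (half_pos hr) B hx)
  have hBT₂ : B ⊆ T₂ := fun x hx => Or.inl (self_subset_thickening hr B hx)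
  -- the closed sets `A₁ ∖ T₂` and `closure T` are disjoint
  have hA₁ : IsClosed {x | F₁ x ≤ 0} := isClosed_le hF₁ continuous_const
  have hsC : IsClosed ({x | F₁ x ≤ 0} ∩ T₂ᶜ) := hA₁.inter hT₂o.isClosed_compl
  have hdisj : Disjoint ({x | F₁ x ≤ 0} ∩ T₂ᶜ) (closure T) := by
    rw [disjoint_iff_inter_eq_empty, eq_empty_iff_forall_notMem]
    rintro x ⟨⟨hF₁x, hxT₂⟩, hxcl⟩
    apply hxT₂
    rw [hT, closure_union] at hxcl
    rcases hxcl with h1 | h2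
    · have h1' : x ∈ cthickening (r / 2) B := closure_thickening_subset_cthickening _ _ h1
      exact Or.inl (cthickening_subset_thickening' hr (half_lt_self hr) B h1')
    · have hxG : x ∈ closure G := closure_mono inter_subset_left h2
      have hwx : w x ≤ 1 + 4 * δ₀ := by
        have : x ∈ closure {x | w x < 1 + 4 * δ₀} := closure_mono inter_subset_right h2
        exact closure_lt_subset_le hw continuous_const this
      rw [closure_eq_self_union_frontier] at hxG
      rcases hxG with hxG | hxfr
      · exact Or.inr ⟨hxG, by show w x < 1 + 5 * δ₀; linarith⟩
      · exact hBT₂ (Hbdry x hxfr hF₁x hwx)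
  obtain ⟨ζ, hζs, hζ0, hζ1, hζ01⟩ := exists_contDiff_zero_one hsC isClosed_closure hdisj
  refine ⟨ζ, T, hζs, hζ01, hTo, hBT, fun x hx => hζ1 x (subset_closure hx), ?_, ?_⟩
  · -- `T ∩ A₁ ∩ {w ≤ 1 + 3δ₀} ⊆ B ∪ G`
    intro x hx hF₁x hwx
    rcases hx with hx | hx
    · exact hloc x (thickening_mono (by linarith) B hx) hF₁x hwx
    · exact Or.inr hx.1
  · -- small capped value forces `x ∈ T`
    intro x hF₁x hval
    have h01 := hζ01 x
    have hwx : w x ≤ 1 + 3 * δ₀ := by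
      by_contra h
      have h' := not_le.1 h
      have hW' : 0 ≤ W - (1 + 3 * δ₀) := by linarith
      by_cases hz : ζ x = 0
      · rw [hz] at hval
        linarith
      · have hzpos : 0 < ζ x := lt_of_le_of_ne h01.1 (Ne.symm hz)
        have : 1 + 3 * δ₀ < ζ x * w x + (1 - ζ x) * W := by
          nlinarith [mul_pos hzpos (sub_pos.2 h'), mul_nonneg (sub_nonneg.2 h01.2) hW']
        linarith
    have hζne : ζ x ≠ 0 := by
      intro h0
      rw [h0] at hval
      linarith
    have hxT₂ : x ∈ T₂ := by
      by_contra h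
      exact hζne (hζ0 x ⟨hF₁x, h⟩)
    rcases hxT₂ with hx | hx
    · rcases hloc x hx hF₁x hwx with hb | hg
      · exact hBT hb
      · exact Or.inr ⟨hg, by show w x < 1 + 4 * δ₀; linarith⟩
    · exact Or.inr ⟨hx.1, by show w x < 1 + 4 * δ₀; linarith⟩

/-- **Capping, avoiding a closed set.**  As `exists_capping`, with in addition `ζ = 0` on a given
closed set `Z` disjoint from `B` and from `closure G` (so that the capped function is the constant
`W` there). [cite: Schultens2014, proof of Thm. 3.2.5 (PDF p. 45)] -/
theorem exists_capping_off {F₁ FB w : E → ℝ} (hF₁ : Continuous F₁) (hFB : Continuous FB)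
    (hw : Continuous w) (hcpt : IsCompact {x | FB x ≤ 0}) {G : Set E} (hG : IsOpen G) {δ₀ : ℝ}
    (hδ₀ : 0 < δ₀)
    (Hagree : ∀ b, FB b = 0 → w b ≤ 1 + 3 * δ₀ → b ∉ G → ∀ᶠ y in 𝓝 b, (F₁ y ≤ 0 ↔ FB y ≤ 0))
    (Hbdry : ∀ x ∈ frontier G, F₁ x ≤ 0 → w x ≤ 1 + 4 * δ₀ → FB x ≤ 0) {W : ℝ}
    (hW : 1 + 6 * δ₀ ≤ W) {Z : Set E} (hZ : IsClosed Z) (hZB : Disjoint Z {x | FB x ≤ 0})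
    (hZG : Disjoint Z (closure G)) :
    ∃ (ζ : E → ℝ) (T : Set E), ContDiff ℝ ∞ ζ ∧ (∀ x, ζ x ∈ Icc (0 : ℝ) 1) ∧ IsOpen T ∧
      {x | FB x ≤ 0} ⊆ T ∧ (∀ x ∈ T, ζ x = 1) ∧
      (∀ x ∈ T, F₁ x ≤ 0 → w x ≤ 1 + 3 * δ₀ → FB x ≤ 0 ∨ x ∈ G) ∧
      (∀ x, F₁ x ≤ 0 → ζ x * w x + (1 - ζ x) * W ≤ 1 + 3 * δ₀ → x ∈ T) ∧
      (G ∩ {x | w x < 1 + 4 * δ₀} ⊆ T) ∧ (∀ x ∈ Z, ζ x = 0) := by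
  obtain ⟨r₀, hr₀, hloc₀⟩ := exists_thickening_forall_mem (F₁ := F₁) hFB hw hcpt hG Hagree
  obtain ⟨rZ, hrZ, hdZ⟩ := hZB.symm.exists_thickenings hcpt hZ
  set r := min r₀ rZ with hr_def
  have hr : 0 < r := lt_min hr₀ hrZ
  set B : Set E := {x | FB x ≤ 0} with hB
  have hloc : ∀ x ∈ thickening r B, F₁ x ≤ 0 → w x ≤ 1 + 3 * δ₀ → FB x ≤ 0 ∨ x ∈ G :=
    fun x hx => hloc₀ x (thickening_mono (min_le_left _ _) B hx)
  set T : Set E := thickening (r / 2) B ∪ (G ∩ {x | w x < 1 + 4 * δ₀}) with hT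
  set T₂ : Set E := thickening r B ∪ (G ∩ {x | w x < 1 + 5 * δ₀}) with hT₂
  have hTo : IsOpen T := isOpen_thickening.union (hG.inter (isOpen_lt hw continuous_const))
  have hT₂o : IsOpen T₂ := isOpen_thickening.union (hG.inter (isOpen_lt hw continuous_const))
  have hBT : B ⊆ T := fun x hx => Or.inl (self_subset_thickening (half_pos hr) B hx)
  have hBT₂ : B ⊆ T₂ := fun x hx => Or.inl (self_subset_thickening hr B hx)
  have hA₁ : IsClosed {x | F₁ x ≤ 0} := isClosed_le hF₁ continuous_const
  have hsC : IsClosed ({x | F₁ x ≤ 0} ∩ T₂ᶜ ∪ Z) := (hA₁.inter hT₂o.isClosed_compl).union hZ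
  -- `closure T ⊆ cthickening (r/2) B ∪ (closure G ∩ {w ≤ 1 + 4δ₀})`
  have hclT : ∀ x ∈ closure T, x ∈ cthickening (r / 2) B ∨ (x ∈ closure G ∧ w x ≤ 1 + 4 * δ₀) := by
    intro x hxcl
    rw [hT, closure_union] at hxcl
    rcases hxcl with h1 | h2
    · exact Or.inl (closure_thickening_subset_cthickening _ _ h1)
    · refine Or.inr ⟨closure_mono inter_subset_left h2, ?_⟩
      have : x ∈ closure {x | w x < 1 + 4 * δ₀} := closure_mono inter_subset_right h2
      exact closure_lt_subset_le hw continuous_const this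
  have hdisj : Disjoint ({x | F₁ x ≤ 0} ∩ T₂ᶜ ∪ Z) (closure T) := by
    rw [disjoint_iff_inter_eq_empty, eq_empty_iff_forall_notMem]
    rintro x ⟨hxs, hxcl⟩
    rcases hxs with ⟨hF₁x, hxT₂⟩ | hxZ
    · apply hxT₂
      rcases hclT x hxcl with h1 | ⟨hxG, hwx⟩
      · exact Or.inl (cthickening_subset_thickening' hr (half_lt_self hr) B h1)
      · rw [closure_eq_self_union_frontier] at hxG
        rcases hxG with hxG | hxfr
        · exact Or.inr ⟨hxG, by show w x < 1 + 5 * δ₀; linarith⟩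
        · exact hBT₂ (Hbdry x hxfr hF₁x hwx)
    · rcases hclT x hxcl with h1 | ⟨hxG, _⟩
      · have hxr : x ∈ thickening rZ B :=
          thickening_mono (min_le_right _ _) B
            (cthickening_subset_thickening' hr (half_lt_self hr) B h1)
        exact (Set.disjoint_left.1 hdZ hxr) (self_subset_thickening hrZ Z hxZ)
      · exact (Set.disjoint_left.1 hZG hxZ) hxG
  obtain ⟨ζ, hζs, hζ0, hζ1, hζ01⟩ := exists_contDiff_zero_one hsC isClosed_closure hdisj
  refine ⟨ζ, T, hζs, hζ01, hTo, hBT, fun x hx => hζ1 x (subset_closure hx), ?_, ?_,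
    fun x hx => Or.inr hx, fun x hx => hζ0 x (Or.inr hx)⟩
  · intro x hx hF₁x hwx
    rcases hx with hx | hx
    · exact hloc x (thickening_mono (half_lt_self hr).le B hx) hF₁x hwx
    · exact Or.inr hx.1
  · intro x hF₁x hval
    have h01 := hζ01 x
    have hwx : w x ≤ 1 + 3 * δ₀ := by
      by_contra h
      have h' := not_le.1 h
      have hW' : 0 ≤ W - (1 + 3 * δ₀) := by linarith
      by_cases hz : ζ x = 0
      · rw [hz] at hval
        linarith
      · have hzpos : 0 < ζ x := lt_of_le_of_ne h01.1 (Ne.symm hz)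
        have : 1 + 3 * δ₀ < ζ x * w x + (1 - ζ x) * W := by
          nlinarith [mul_pos hzpos (sub_pos.2 h'), mul_nonneg (sub_nonneg.2 h01.2) hW']
        linarith
    have hζne : ζ x ≠ 0 := by
      intro h0
      rw [h0] at hval
      linarith
    have hxT₂ : x ∈ T₂ := by
      by_contra h
      exact hζne (hζ0 x (Or.inl ⟨hF₁x, h⟩))
    rcases hxT₂ with hx | hx
    · rcases hloc x hx hF₁x hwx with hb | hg
      · exact hBT hb
      · exact Or.inr ⟨hg, by show w x < 1 + 4 * δ₀; linarith⟩
    · exact Or.inr ⟨hx.1, by show w x < 1 + 4 * δ₀; linarith⟩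

end Literature.Topology.FourManifolds.SweepCapping
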